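import Summits.HubbardSuperconductivity.HubbardSuperconductivity.Theorems.BalabanIRBirComplexStableXYRFluxTwistStructure
import Literature.MathematicalPhysics.QuantumFieldTheory.TiltedThetaSeriesPositivity
import Literature.MathematicalPhysics.QuantumFieldTheory.VillainAngleForm
import Literature.Analysis.SpecialFunctions.TiltedThetaPoisson
import HarnessLib

/-!
# Crux `BirComplexStableXYR` (stmt-HubbardSuperconductivity-14845), line `fat-gaussian-defect-calculus`, chapter 2
# §2.1: the flux sum at FIXED VORTICITY — a sharp, shift-uniform bound

Support file (prover seat 1, route BalabanIR; item G2 — sector sums).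

`…GaussianSectorSum` bounded the full Gaussian sector partition function crudely (flux factor `G(4π²Kc₀/|Λ|)³`).  At fixed
vorticity the `h`-dependence is an exact shifted Gaussian (`stub_fixedVorticityFlux`, `stub_fluxTwistStructure`, lead c8's
E3), so the flux sum can be bounded SHARPLY and uniformly in the vortex-dependent shift:

* **`stub_fixedVorticityFluxSum`** (registered stub): for a table with `Σ c_n = 0`, coercivity (C), `r ≥ 2`, ANY strain map
  `σ` with the two properties of `stub_fsRepresentation`, every `K > 0` and every reference tree-gauge cochain `b`, the
  weights `h ↦ exp(−(K/2)𝒬(σ(b + seam h)))` are summable over `ℤ³` and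
  `Σ_h exp(−(K/2)𝒬(σ(b + seam h))) ≤ exp(−Kc₀‖coexact d₁(2πb)‖²) · G(4π²Kc₀|Λ|/L²)² · G(4π²Kc₀|Λ|/M²)`,
  `G = gaussLatticeSum` — the Coulomb energy of the vortex configuration times the flux factor of the vortex-FREE sum
  (on `Λ L M`: `G(4π²Kc₀M)² · G(4π²Kc₀L²/M)`, i.e. `O(1 + √(M/(Kc₀L²)))` thermally accessible temporal fluxes).
  Proof: complete the square in the real flux with the positive definite stiffness matrix, bound the minimum over real
  fluxes by the Coulomb energy (`scl_coulomb_lower`), compare with the diagonal form `8π²Kc₀|Λ|diag(N_i⁻²)`, and use that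
  shifted lattice Gaussian sums are maximal at zero shift (`GaussianPoisson.tsum_exp_neg_half_form_sub_le_tsum`).

No definitions; sorry-free. [folklore: Fröhlich–Spencer, CMP 81 (1981) §3–4]
-/

noncomputable section

namespace Summit.HubbardSuperconductivity.HubbardSuperconductivity.Theorems

set_option linter.dupNamespace false -- summit = problem name (single-conjunct summit), D-0017

open scoped BigOperators ComplexConjugate
open Complex Matrix Summit.HubbardSuperconductivity.BirComplexStableXYNegative
open Literature.Probability.LatticeModels Literature.MathematicalPhysics.QuantumFieldTheory
open Literature.Analysis.SpecialFunctions

section FixedVorticityFluxSum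

variable {r : ℕ} {L M : ℕ} [NeZero L] [NeZero M]

/-- `b + seam h` vanishes on the comb if `b` does. [folklore] -/
theorem fvs_add_seam_comb
    (b : {a : Λ L M → Fin 3 → ℤ // ∀ (y : Λ L M) (μ : Fin 3),
      (∀ ν : Fin 3, μ < ν → (TorusChart.piProdZMod 2 L M).cval ν y = 0) →
      (TorusChart.piProdZMod 2 L M).cval μ y + 1 < (TorusChart.piProdZMod 2 L M).period μ → a y μ = 0})
    (h : Fin 3 → ℤ) :
    ∀ (y : Λ L M) (μ : Fin 3), (∀ ν : Fin 3, μ < ν → (TorusChart.piProdZMod 2 L M).cval ν y = 0) →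
      (TorusChart.piProdZMod 2 L M).cval μ y + 1 < (TorusChart.piProdZMod 2 L M).period μ →
      (b.1 + (TorusChart.piProdZMod 2 L M).seam h) y μ = 0 :=
  fun y μ hν hμ => by
    rw [Pi.add_apply, Pi.add_apply, b.2 y μ hν hμ, (TorusChart.piProdZMod 2 L M).seam_of_lt h y μ hμ, add_zero]

/-- The curl of a constant cochain vanishes. [folklore] -/
theorem fvs_d₁_const {Λ' : Type*} [AddCommGroup Λ'] {d : ℕ} (F : TorusChart Λ' d) (v : Fin d → ℝ) :
    F.d₁ (fun (_ : Λ') (i : Fin d) => v i) = 0 := by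
  funext x i j
  simp only [TorusChart.d₁_apply, Pi.zero_apply]
  ring

/-- **Completing the square** for a symmetric matrix with `S *ᵥ t = ℓ`:
`c + 2 x·ℓ + xᵀSx = (x + t)ᵀS(x + t) + (c − 2 t·ℓ + tᵀSt)`. [folklore] -/
theorem fvs_complete_square {n : ℕ} (S : Matrix (Fin n) (Fin n) ℝ) (hS : S.IsSymm) (ℓ t x : Fin n → ℝ)
    (ht : S *ᵥ t = ℓ) (c : ℝ) :
    c + 2 * (x ⬝ᵥ ℓ) + x ⬝ᵥ S *ᵥ x = (x + t) ⬝ᵥ S *ᵥ (x + t) + (c + 2 * ((-t) ⬝ᵥ ℓ) + (-t) ⬝ᵥ S *ᵥ (-t)) := by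
  have hsym : ∀ u v : Fin n → ℝ, u ⬝ᵥ S *ᵥ v = v ⬝ᵥ S *ᵥ u := by
    intro u v
    rw [dotProduct_mulVec, ← Matrix.mulVec_transpose, hS.eq, dotProduct_comm]
  have h1 : (x + t) ⬝ᵥ S *ᵥ (x + t) = x ⬝ᵥ S *ᵥ x + 2 * (x ⬝ᵥ ℓ) + t ⬝ᵥ ℓ := by
    rw [mulVec_add, add_dotProduct, dotProduct_add, dotProduct_add, ht, hsym t x]
    have : x ⬝ᵥ S *ᵥ t = x ⬝ᵥ ℓ := by rw [ht]
    rw [this]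
    ring
  have h2 : (-t) ⬝ᵥ S *ᵥ (-t) = t ⬝ᵥ ℓ := by
    rw [mulVec_neg, neg_dotProduct, dotProduct_neg, neg_neg, ht]
  rw [h1, h2, neg_dotProduct]
  ring

/-- **Registered stub `stub_fixedVorticityFluxSum` (prover seat 1 on stmt-HubbardSuperconductivity-14845; chapter 2 §2.1):
the flux sum at fixed vorticity.**  For a table with `Σ c_n = 0`, coercivity (C), `r ≥ 2`, ANY strain map `σ` with
the two properties of `stub_fsRepresentation`, every `K > 0` and every reference tree-gauge cochain `b`:
`h ↦ exp(−(K/2)𝒬(σ(b + seam h)))` is summable over `ℤ³` and its sum is at most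
`exp(−Kc₀ Σ_{x,i} (coexact d₁(2πb))(x,i)²) · G(4π²Kc₀|Λ|/L²)² · G(4π²Kc₀|Λ|/M²)`, `G = gaussLatticeSum`. [folklore] -/
theorem stub_fixedVorticityFluxSum : ∀ (r : ℕ) (c : Table r) (c₀ : ℝ), 2 ≤ r → 0 < c₀ → c.sum (fun _ a => a) = 0 → (∀ φ : W r → ℝ, c₀ * ∑ w, ∑ w', (1 - Real.cos (φ w - φ w')) ≤ (genF c φ).re) → ∀ (L M : ℕ) [NeZero L] [NeZero M] (P : (Λ L M → Fin 3 → ℝ) → Λ L M → W r → ℝ), (∀ (ω : Λ L M → Fin 3 → ℝ) (s : Λ L M) (w : W r), P ω s w = (TorusChart.piProdZMod 2 L M).lineSum ω 0 (w.1 : ℕ) s + (TorusChart.piProdZMod 2 L M).lineSum ω 1 (w.2.1 : ℕ) (s + (w.1 : ℕ) • (TorusChart.piProdZMod 2 L M).gen 0) + (TorusChart.piProdZMod 2 L M).lineSum ω 2 (w.2.2 : ℕ) (s + (w.1 : ℕ) • (TorusChart.piProdZMod 2 L M).gen 0 + (w.2.1 : ℕ) • (TorusChart.piProdZMod 2 L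 M).gen 1)) → ∀ (Q : (W r → ℝ) → ℝ), (∀ u : W r → ℝ, Q u = (-c.sum (fun n a => a * (((∑ w, (n w : ℝ) * u w) ^ 2 : ℝ) : ℂ))).re) → ∀ (σ : {a : Λ L M → Fin 3 → ℤ // ∀ (y : Λ L M) (μ : Fin 3), (∀ ν : Fin 3, μ < ν → (TorusChart.piProdZMod 2 L M).cval ν y = 0) → (TorusChart.piProdZMod 2 L M).cval μ y + 1 < (TorusChart.piProdZMod 2 L M).period μ → a y μ = 0} → (Λ L M → Fin 3 → ℝ)), (∀ a, ∃ ψ : Λ L M → ℝ, σ a = fun x i => 2 * Real.pi * (a.1 x i : ℝ) - (TorusChart.piProdZMod 2 L M).d₀ ψ x i) → (∀ a (u : Λ L M → ℝ), ∑ s : Λ L M, Q (P (fun x i => (TorusChart.piProdZMod 2 L M).d₀ u x i - σ a x i) s) = ∑ s : Λ L M, Q (P ((TorusChart.piProdZMod 2 L M).d₀ u) s) + ∑ s : Λ L M, Q (P (σ a) s)) → ∀ (K : ℝ), 0 < K → ∀ (b : {a : Λ L M → Fin 3 → ℤ // ∀ (y : Λ L M) (μ : Fin 3), (∀ ν : Fin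 3, μ < ν → (TorusChart.piProdZMod 2 L M).cval ν y = 0) → (TorusChart.piProdZMod 2 L M).cval μ y + 1 < (TorusChart.piProdZMod 2 L M).period μ → a y μ = 0}), Summable (fun h : Fin 3 → ℤ => Real.exp (-(K / 2 * ∑ s : Λ L M, Q (P (σ ⟨b.1 + (TorusChart.piProdZMod 2 L M).seam h, fvs_add_seam_comb b h⟩) s)))) ∧ ∑' h : Fin 3 → ℤ, Real.exp (-(K / 2 * ∑ s : Λ L M, Q (P (σ ⟨b.1 + (TorusChart.piProdZMod 2 L M).seam h, fvs_add_seam_comb b h⟩) s))) ≤ Real.exp (-(K * c₀ * ∑ x : Λ L M, ∑ i : Fin 3, ((TorusChart.piProdZMod 2 L M).coexact ((TorusChart.piProdZMod 2 L M).d₁ (fun x i => 2 * Real.pi * (b.1 x i : ℝ))) x i) ^ 2)) * gaussLatticeSum (4 * Real.pi ^ 2 * K * c₀ * (Fintype.card (Λ L M) : ℝ) / (L : ℝ) ^ 2) ^ 2 * gaussLatticeSum (4 * Real.pi ^ 2 * K * c₀ * (Fintype.card (Λ L M) : ℝ) / (M : ℝ) ^ 2) := by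
  intro r c c₀ hr hc₀ hA hC L M _ _ P hP Q hQ σ hcls hpy K hK b
  obtain ⟨B, hBsymm, hBdiag⟩ := FSUnfolding.stub_thinFormPolar r c L M P hP Q hQ
  obtain ⟨hadd, _, _⟩ := stub_strainAdditive r c c₀ hr hc₀ hA hC L M P hP Q hQ σ hcls hpy
  have hper0 : (TorusChart.piProdZMod 2 L M).period 0 = L := TorusChart.piProdZMod_period_castSucc 2 L M 0
  have hper1 : (TorusChart.piProdZMod 2 L M).period 1 = L := TorusChart.piProdZMod_period_castSucc 2 L M 1
  have hper2 : (TorusChart.piProdZMod 2 L M).period 2 = M := TorusChart.piProdZMod_period_last 2 L M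
  have hcard : (0 : ℝ) < Fintype.card (Λ L M) := TorusChart.card_pos_real (Λ := Λ L M)
  have hL : (0 : ℝ) < L := by exact_mod_cast Nat.pos_of_ne_zero (NeZero.ne L)
  have hM : (0 : ℝ) < M := by exact_mod_cast Nat.pos_of_ne_zero (NeZero.ne M)
  have hperpos : ∀ i : Fin 3, (0 : ℝ) < (TorusChart.piProdZMod 2 L M).period i := fun i => by
    exact_mod_cast (TorusChart.piProdZMod 2 L M).period_pos i
  -- the thin form unfolded (for coercivity)
  have hQP : ∀ (η : Λ L M → Fin 3 → ℝ) (s : Λ L M), Q (P η s)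
      = (-c.sum (fun n a => a * (((∑ w : W r, (n w : ℝ) *
          ((TorusChart.piProdZMod 2 L M).lineSum η 0 (w.1 : ℕ) s
            + (TorusChart.piProdZMod 2 L M).lineSum η 1 (w.2.1 : ℕ) (s + (w.1 : ℕ) • (TorusChart.piProdZMod 2 L M).gen 0)
            + (TorusChart.piProdZMod 2 L M).lineSum η 2 (w.2.2 : ℕ)
              (s + (w.1 : ℕ) • (TorusChart.piProdZMod 2 L M).gen 0
                + (w.2.1 : ℕ) • (TorusChart.piProdZMod 2 L M).gen 1))) ^ 2 : ℝ) : ℂ))).re := by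
    intro η s; rw [hQ]; simp only [hP]
  -- the constant unit twists `v i = (2π (e_i)_μ / N_μ)_μ` (lead c8's E3) and the strains of `b + seam h`
  have hE1 := FSUnfolding.stub_constCochainPythagoras r c L M P hP Q hQ
  set κ : (Fin 3 → ℝ) → (Λ L M → Fin 3 → ℝ) :=
    fun x _ μ => 2 * Real.pi * x μ / ((TorusChart.piProdZMod 2 L M).period μ : ℝ) with hκ
  have hκlin : ∀ x : Fin 3 → ℝ, κ x = ∑ i : Fin 3, x i • κ (fun μ => ((Pi.single i (1 : ℤ) : Fin 3 → ℤ) μ : ℝ)) := by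
    intro x
    funext y μ
    simp only [hκ, Finset.sum_apply, Pi.smul_apply, smul_eq_mul, Pi.single_apply, Int.cast_ite, Int.cast_one,
      Int.cast_zero, mul_ite, mul_one, mul_zero, Fin.sum_univ_three]
    fin_cases μ <;> simp <;> ring
  have hstrain : ∀ h : Fin 3 → ℤ, σ ⟨b.1 + (TorusChart.piProdZMod 2 L M).seam h, fvs_add_seam_comb b h⟩
      = σ b + κ (fun μ => (h μ : ℝ)) := by
    intro h
    have h1 := hadd b ⟨(TorusChart.piProdZMod 2 L M).seam h, hth_seam_comb h⟩
    have h2 : (⟨b.1 + (TorusChart.piProdZMod 2 L M).seam h, fun y μ hν hμ => by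
        rw [Pi.add_apply, Pi.add_apply, b.2 y μ hν hμ, hth_seam_comb h y μ hν hμ, add_zero]⟩ :
        {a : Λ L M → Fin 3 → ℤ // ∀ (y : Λ L M) (μ : Fin 3),
          (∀ ν : Fin 3, μ < ν → (TorusChart.piProdZMod 2 L M).cval ν y = 0) →
          (TorusChart.piProdZMod 2 L M).cval μ y + 1 < (TorusChart.piProdZMod 2 L M).period μ → a y μ = 0})
        = ⟨b.1 + (TorusChart.piProdZMod 2 L M).seam h, fvs_add_seam_comb b h⟩ := rfl
    rw [h2] at h1
    rw [h1]
    congr 1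
    exact FSUnfolding.stub_holonomyStrainConst r c c₀ hr hc₀ hA hC L M P hP Q hQ hE1 h
      ((TorusChart.piProdZMod 2 L M).seam h) ((TorusChart.piProdZMod 2 L M).d₁_seam h)
      ((TorusChart.piProdZMod 2 L M).wind_seam h) _ (hcls _) (hpy _)
  -- the stiffness matrix, the linear coefficients, and the quadratic expansion on REAL fluxes
  set v : Fin 3 → (Λ L M → Fin 3 → ℝ) := fun i => κ (fun μ => ((Pi.single i (1 : ℤ) : Fin 3 → ℤ) μ : ℝ)) with hv
  set S : Matrix (Fin 3) (Fin 3) ℝ := Matrix.of fun i j => B (v i) (v j) with hSdef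
  set ℓ : Fin 3 → ℝ := fun i => B (σ b) (v i) with hℓ
  have hSsymm : S.IsSymm := by
    refine Matrix.IsSymm.ext fun i j => ?_
    simp only [hSdef, Matrix.of_apply]
    exact hBsymm _ _
  have hquadR : ∀ x : Fin 3 → ℝ, ∑ s : Λ L M, Q (P (σ b + κ x) s)
      = ∑ s : Λ L M, Q (P (σ b) s) + 2 * (x ⬝ᵥ ℓ) + x ⬝ᵥ S *ᵥ x := by
    intro x
    rw [← hBdiag, ← hBdiag, hκlin x]
    have hw : ∑ i : Fin 3, x i • κ (fun μ => ((Pi.single i (1 : ℤ) : Fin 3 → ℤ) μ : ℝ)) = ∑ i : Fin 3, x i • v i := rfl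
    rw [hw]
    simp only [map_add, LinearMap.add_apply]
    rw [hBsymm (∑ i : Fin 3, x i • v i) (σ b), hth_bilin_expand B v x]
    have hlin : B (σ b) (∑ i : Fin 3, x i • v i) = x ⬝ᵥ ℓ := by
      rw [map_sum]
      simp only [map_smul, smul_eq_mul, hℓ, dotProduct]
    have hform : ∑ i : Fin 3, ∑ j : Fin 3, B (v i) (v j) * x i * x j = x ⬝ᵥ S *ᵥ x := by
      simp only [hSdef, dotProduct, Matrix.mulVec, Matrix.of_apply, Finset.mul_sum]
      exact Finset.sum_congr rfl fun i _ => Finset.sum_congr rfl fun j _ => by ring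
    rw [hlin, hform]
    ring
  -- lower bound on REAL fluxes by the Coulomb energy of the vortex configuration (no Pythagoras needed)
  set E : ℝ := ∑ x : Λ L M, ∑ i : Fin 3, ((TorusChart.piProdZMod 2 L M).coexact
      ((TorusChart.piProdZMod 2 L M).d₁ (fun x i => 2 * Real.pi * (b.1 x i : ℝ))) x i) ^ 2 with hE
  have hlowR : ∀ x : Fin 3 → ℝ, 2 * c₀ * E ≤ ∑ s : Λ L M, Q (P (σ b + κ x) s) := by
    intro x
    obtain ⟨ψ, hψ⟩ := hcls b
    have hσ' : σ b + κ x = fun y i => (2 * Real.pi * (b.1 y i : ℝ) + κ x y i) - (TorusChart.piProdZMod 2 L M).d₀ ψ y i := by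
      funext y i
      simp only [Pi.add_apply, hψ]
      ring
    have h := scl_coulomb_lower c hr hc₀ hA hC P hP Q hQ (fun y i => 2 * Real.pi * (b.1 y i : ℝ) + κ x y i) (σ b + κ x) ψ hσ'
    refine le_trans ?_ h
    refine mul_le_mul_of_nonneg_left ?_ (by positivity)
    rw [(TorusChart.piProdZMod 2 L M).sum_sq_coexact_add_harm₁]
    have hd₁ : (TorusChart.piProdZMod 2 L M).d₁ (fun y i => 2 * Real.pi * (b.1 y i : ℝ) + κ x y i)
        = (TorusChart.piProdZMod 2 L M).d₁ (fun y i => 2 * Real.pi * (b.1 y i : ℝ)) := by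
      have hsplit : (fun y i => 2 * Real.pi * (b.1 y i : ℝ) + κ x y i)
          = (fun y i => 2 * Real.pi * (b.1 y i : ℝ)) + (fun (_ : Λ L M) (μ : Fin 3) => 2 * Real.pi * x μ / ((TorusChart.piProdZMod 2 L M).period μ : ℝ)) := by
        funext y i; simp [hκ]
      rw [hsplit, (TorusChart.piProdZMod 2 L M).d₁_add, fvs_d₁_const, add_zero]
    rw [hd₁]
    have hh : 0 ≤ ∑ y : Λ L M, ∑ i : Fin 3, (TorusChart.harm₁ (fun y i => 2 * Real.pi * (b.1 y i : ℝ) + κ x y i) y i) ^ 2 :=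
      Finset.sum_nonneg fun _ _ => Finset.sum_nonneg fun _ _ => sq_nonneg _
    linarith
  -- coercivity of the stiffness form on REAL fluxes: `xᵀSx = 𝒬(κ_x) ≥ 2c₀‖κ_x‖² = 8π²c₀|Λ|Σ x_μ²/N_μ²`
  have hcoerS : ∀ x : Fin 3 → ℝ, 8 * Real.pi ^ 2 * c₀ * (Fintype.card (Λ L M) : ℝ)
      * ∑ μ : Fin 3, (x μ) ^ 2 / ((TorusChart.piProdZMod 2 L M).period μ : ℝ) ^ 2 ≤ x ⬝ᵥ S *ᵥ x := by
    intro x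
    have hform : x ⬝ᵥ S *ᵥ x = ∑ s : Λ L M, Q (P (κ x) s) := by
      have h := hquadR x
      have h0 := hquadR 0
      simp only [zero_dotProduct, mul_zero, add_zero] at h0
      -- `𝒬(κ_x) = B(κ_x, κ_x) = xᵀSx` directly
      rw [← hBdiag, hκlin x]
      have hw : ∑ i : Fin 3, x i • κ (fun μ => ((Pi.single i (1 : ℤ) : Fin 3 → ℤ) μ : ℝ)) = ∑ i : Fin 3, x i • v i := rfl
      rw [hw, hth_bilin_expand B v x]
      simp only [hSdef, dotProduct, Matrix.mulVec, Matrix.of_apply, Finset.mul_sum]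
      exact Finset.sum_congr rfl fun i _ => Finset.sum_congr rfl fun j _ => by ring
    rw [hform]
    have hcoer := FSUnfolding.stub_thinFormCoercive r c c₀ hr hc₀ hA hC L M (κ x)
    rw [← Finset.sum_congr rfl fun s _ => hQP (κ x) s] at hcoer
    refine le_trans (le_of_eq ?_) hcoer
    simp only [hκ, Finset.sum_const, Finset.card_univ, nsmul_eq_mul, Finset.mul_sum]
    refine Finset.sum_congr rfl fun μ _ => ?_
    have hp := hperpos μ
    field_simp
    ring
  -- positive definiteness and the completed square
  have hSpd : S.PosDef := by
    refine Matrix.PosDef.of_dotProduct_mulVec_pos ?_ fun x hx => ?_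
    · exact Matrix.IsHermitian.ext fun i j => by simpa [hSdef] using hBsymm (v j) (v i)
    · rw [star_trivial]
      refine lt_of_lt_of_le ?_ (hcoerS x)
      have hx' : 0 < ∑ μ : Fin 3, (x μ) ^ 2 / ((TorusChart.piProdZMod 2 L M).period μ : ℝ) ^ 2 := by
        obtain ⟨μ, hμ⟩ : ∃ μ, x μ ≠ 0 := by
          by_contra hall
          push Not at hall
          exact hx (funext hall)
        refine lt_of_lt_of_le ?_ (Finset.single_le_sum (fun ν _ => div_nonneg (sq_nonneg (x ν)) (sq_nonneg _))
          (Finset.mem_univ μ))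
        have hp := hperpos μ
        positivity
      positivity
  have hSunit : IsUnit S.det := (Matrix.isUnit_iff_isUnit_det _).1 hSpd.isUnit
  set t : Fin 3 → ℝ := S⁻¹ *ᵥ ℓ with htdef
  have hSt : S *ᵥ t = ℓ := by
    rw [htdef, Matrix.mulVec_mulVec, Matrix.mul_nonsing_inv S hSunit, Matrix.one_mulVec]
  have hsq : ∀ x : Fin 3 → ℝ, ∑ s : Λ L M, Q (P (σ b + κ x) s)
      = (x + t) ⬝ᵥ S *ᵥ (x + t) + ∑ s : Λ L M, Q (P (σ b + κ (-t)) s) := by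
    intro x
    rw [hquadR x, hquadR (-t)]
    exact fvs_complete_square S hSsymm ℓ t x hSt _
  -- the diagonal comparison form `D = 8π²Kc₀|Λ| diag(N_μ⁻²)` and the domination of the weights
  set dvec : Fin 3 → ℝ := fun μ => 8 * Real.pi ^ 2 * K * c₀ * (Fintype.card (Λ L M) : ℝ)
      / ((TorusChart.piProdZMod 2 L M).period μ : ℝ) ^ 2 with hdvec
  have hdpos : ∀ μ, 0 < dvec μ := fun μ => by have hp := hperpos μ; simp only [hdvec]; positivity
  set D : Matrix (Fin 3) (Fin 3) ℝ := Matrix.diagonal dvec with hD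
  have hDpd : D.PosDef := Matrix.PosDef.diagonal hdpos
  have hDform : ∀ y : Fin 3 → ℝ, y ⬝ᵥ D *ᵥ y = ∑ μ : Fin 3, dvec μ * (y μ) ^ 2 := by
    intro y
    simp only [hD, dotProduct, Matrix.mulVec_diagonal]
    exact Finset.sum_congr rfl fun μ _ => by ring
  have hdom : ∀ h : Fin 3 → ℤ,
      Real.exp (-(K / 2 * ∑ s : Λ L M, Q (P (σ ⟨b.1 + (TorusChart.piProdZMod 2 L M).seam h, fvs_add_seam_comb b h⟩) s)))
        ≤ Real.exp (-(K * c₀ * E))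
          * Real.exp (-((fun j => ((h j : ℝ)) - (-t) j) ⬝ᵥ D *ᵥ (fun j => ((h j : ℝ)) - (-t) j)) / 2) := by
    intro h
    rw [← Real.exp_add]
    apply Real.exp_le_exp.2
    rw [hstrain h, hsq (fun μ => (h μ : ℝ))]
    have hmin := hlowR (-t)
    have hy : (fun j => ((h j : ℝ)) - (-t) j) = (fun μ => (h μ : ℝ)) + t := by
      funext j; simp
    rw [hy, hDform]
    have hS' := hcoerS ((fun μ => (h μ : ℝ)) + t)
    have hKD : K / 2 * (8 * Real.pi ^ 2 * c₀ * (Fintype.card (Λ L M) : ℝ)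
        * ∑ μ : Fin 3, (((fun μ => (h μ : ℝ)) + t) μ) ^ 2 / ((TorusChart.piProdZMod 2 L M).period μ : ℝ) ^ 2)
        = (∑ μ : Fin 3, dvec μ * (((fun μ => (h μ : ℝ)) + t) μ) ^ 2) / 2 := by
      simp only [hdvec, Finset.mul_sum, Finset.sum_div]
      exact Finset.sum_congr rfl fun μ _ => by ring
    have hK2 : 0 ≤ K / 2 := by positivity
    nlinarith [mul_le_mul_of_nonneg_left hS' hK2, mul_le_mul_of_nonneg_left hmin hK2, hKD]
  -- summability and the bound
  have hsumD := GaussianPoisson.summable_exp_neg_half_form_sub hDpd (-t)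
  have hnonneg : ∀ h : Fin 3 → ℤ, 0 ≤ Real.exp (-(K / 2 * ∑ s : Λ L M,
      Q (P (σ ⟨b.1 + (TorusChart.piProdZMod 2 L M).seam h, fvs_add_seam_comb b h⟩) s))) := fun _ => (Real.exp_pos _).le
  have hsumRHS := hsumD.mul_left (Real.exp (-(K * c₀ * E)))
  have hS : Summable (fun h : Fin 3 → ℤ => Real.exp (-(K / 2 * ∑ s : Λ L M,
      Q (P (σ ⟨b.1 + (TorusChart.piProdZMod 2 L M).seam h, fvs_add_seam_comb b h⟩) s)))) :=
    hsumRHS.of_nonneg_of_le hnonneg hdom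
  refine ⟨hS, ?_⟩
  -- zero shift is maximal, and the diagonal sum factorises
  have hshift := GaussianPoisson.tsum_exp_neg_half_form_sub_le_tsum hDpd (-t)
  have hg_nonneg : ∀ (μ : Fin 3) (n : ℤ), 0 ≤ Real.exp (-(dvec μ / 2 * (n : ℝ) ^ 2)) := fun _ _ => (Real.exp_pos _).le
  have hgsum : ∀ μ : Fin 3, Summable (fun n : ℤ => Real.exp (-(dvec μ / 2 * (n : ℝ) ^ 2))) := by
    intro μ
    have h := summable_exp_neg_mul_sq_mul_cos (half_pos (hdpos μ)) 0
    simp only [zero_mul, Real.cos_zero, mul_one] at h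
    exact h
  obtain ⟨_, hprod⟩ := VillainAngle.tsum_pi_prod_real (fun μ n => Real.exp (-(dvec μ / 2 * (n : ℝ) ^ 2))) hg_nonneg hgsum
  have hdiag0 : ∑' k : Fin 3 → ℤ, Real.exp (-((fun j => (k j : ℝ)) ⬝ᵥ D *ᵥ fun j => (k j : ℝ)) / 2)
      = ∏ μ : Fin 3, ∑' n : ℤ, Real.exp (-(dvec μ / 2 * (n : ℝ) ^ 2)) := by
    rw [← hprod]
    refine tsum_congr fun k => ?_
    rw [hDform, ← Real.exp_sum]
    congr 1
    rw [neg_div, Finset.sum_div, ← Finset.sum_neg_distrib]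
    exact Finset.sum_congr rfl fun μ _ => by ring
  have hGprod : ∏ μ : Fin 3, ∑' n : ℤ, Real.exp (-(dvec μ / 2 * (n : ℝ) ^ 2))
      = gaussLatticeSum (4 * Real.pi ^ 2 * K * c₀ * (Fintype.card (Λ L M) : ℝ) / (L : ℝ) ^ 2) ^ 2
        * gaussLatticeSum (4 * Real.pi ^ 2 * K * c₀ * (Fintype.card (Λ L M) : ℝ) / (M : ℝ) ^ 2) := by
    rw [Fin.prod_univ_three]
    simp only [gaussLatticeSum, hdvec, hper0, hper1, hper2]
    have e1 : ∀ (N : ℝ) (n : ℤ), -(8 * Real.pi ^ 2 * K * c₀ * (Fintype.card (Λ L M) : ℝ) / N ^ 2 / 2 * (n : ℝ) ^ 2)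
        = -(4 * Real.pi ^ 2 * K * c₀ * (Fintype.card (Λ L M) : ℝ) / N ^ 2 * (n : ℝ) ^ 2) := by
      intro N n; ring
    simp only [e1]
    ring
  calc ∑' h : Fin 3 → ℤ, Real.exp (-(K / 2 * ∑ s : Λ L M,
        Q (P (σ ⟨b.1 + (TorusChart.piProdZMod 2 L M).seam h, fvs_add_seam_comb b h⟩) s)))
      ≤ ∑' h : Fin 3 → ℤ, Real.exp (-(K * c₀ * E))
          * Real.exp (-((fun j => ((h j : ℝ)) - (-t) j) ⬝ᵥ D *ᵥ (fun j => ((h j : ℝ)) - (-t) j)) / 2) :=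
        hS.tsum_le_tsum hdom hsumRHS
    _ = Real.exp (-(K * c₀ * E)) * ∑' h : Fin 3 → ℤ,
          Real.exp (-((fun j => ((h j : ℝ)) - (-t) j) ⬝ᵥ D *ᵥ (fun j => ((h j : ℝ)) - (-t) j)) / 2) := tsum_mul_left
    _ ≤ Real.exp (-(K * c₀ * E)) * ∑' k : Fin 3 → ℤ,
          Real.exp (-((fun j => (k j : ℝ)) ⬝ᵥ D *ᵥ fun j => (k j : ℝ)) / 2) :=
        mul_le_mul_of_nonneg_left hshift (Real.exp_pos _).le
    _ = _ := by rw [hdiag0, hGprod]; ring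

end FixedVorticityFluxSum

end Summit.HubbardSuperconductivity.HubbardSuperconductivity.Theorems

end
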